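import Summits.BirchSwinnertonDyer.BirchSwinnertonDyer.Theorems.AlignedTransportAtTwoMainConjectureOfRankZeroBSDAtTwoPointFieldCarrierCMIff
import Summits.BirchSwinnertonDyer.BirchSwinnertonDyer.Theorems.AlignedTransportAtTwoMainConjectureOfRankZeroBSDAtTwoCubicNarrowRankDoorModelsAnyRung
import HarnessLib

/-!
# Route `AlignedTransportAtTwo`, crux C2 `MainConjectureOfRankZeroBSDAtTwo` (stmt-BirchSwinnertonDyer-22298):
# PFμ⁺ IS DATA-SHAPED — its conclusion for `W` holds IFF the NARROW `2`-rank of the cubic point field stabilises at SOME pair of consecutive layers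

Sequel of `…PointFieldCarrierCM{,Iff}` (same seat `bsd-line-att-p3` g34). HONEST FRAMING: WIDTH-5 attached prover seat on line `birth` of the lead
`bsd-line-att-p2`; `--supports` stmt-BirchSwinnertonDyer-22298, closes nothing; BSD is NOT proved; crux C2, its verdict «blocked-on
`Rank1Residual.GreenbergMuConjectureIrreducible`» and every registered stub untouched (PFμ⁺ = `PointFieldMuCycAtTwo` stays OPEN: an EQUIVALENT,
finitely-shaped reformulation is given, no class group is computed). THEOREMS ONLY.

* ★★★ `classicalMuVanishes_sup_adjoin_I_iff_exists_narrowRung_of_isOrdinaryAt` — `W` globally minimal, good ordinary at `2`, no rational `2`-torsion abscissa,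
  `Δ_W ∉ ℚ²` (the crux's binders, BOTH signs), `i² = −1`, `β_j` a `2`-torsion abscissa: **«`μ₂ = 0` for every cyclotomic `ℤ₂`-extension of
  `ℚ(W[2]) ⊔ ℚ⟮i⟯`» (PFμ⁺'s conclusion for `W`, `i`) ⟺ «for SOME `m ≥ 0`, every cyclotomic `ℤ₂`-extension `κP` of `ℚ⟮β_j⟯` has
  `[Cl⁺(ℚ(β_j)_{m+1}) : Cl⁺(ℚ(β_j)_{m+1})²] = [Cl⁺(ℚ(β_j)_m) : Cl⁺(ℚ(β_j)_m)²]`»** — part Iff §7 (PFμ⁺ ⟺ Kida-lite narrow data of the cubic) composed with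
  att-p4 g26's `exists_narrowRung_anyRung_iff_narrowMuData` (narrow rung ⟺ narrow data; Fukuda index `0` by att-p5 g28). So the registered stub is,
  curve by curve, a NARROW RANK-STABILISATION statement about ONE explicit cubic field — the `Δ_W < 0` three quarters and the `Δ_W > 0` quarter alike
  (on `Δ_W < 0` the plain rung already suffices, att-p4 g25/g26).

References: [Fukuda1994] Thm. 1 (2), p. 264; [Iwasawa1973MuInvariants] Thm. 2/3, §3–§4; [Washington1997] §13.3 Prop. 13.22–13.23; tree: this seat's
`…PointFieldCarrierCMIff`, att-p4 g26 `…CubicNarrowRankDoorModelsAnyRung` / `NarrowDefectBoundedOfClassicalMuAdjoinI`, bsd-2adic `NarrowFukuda*`.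
-/

set_option linter.dupNamespace false
set_option autoImplicit false

noncomputable section

open scoped Classical NumberField

namespace Summit.BirchSwinnertonDyer.BirchSwinnertonDyer.Theorems.AlignedTransportAtTwoPointFieldCarrierCMNarrowRung

open NumberField Polynomial WeierstrassCurve IntermediateField Field
  Literature.NumberTheory.EllipticCurves Literature.NumberTheory.EllipticCurves.Greenberg1999
  Literature.NumberTheory.EllipticCurves.DokchitserDokchitser2012
  Literature.NumberTheory.EllipticCurves.ZpExtension Literature.NumberTheory.GaloisRepresentations
  Literature.NumberTheory.IwasawaTheory
  Summit.BirchSwinnertonDyer.BirchSwinnertonDyer.Theorems.AlignedTransportAtTwoFineRoad.DivisionCubic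
  Summit.BirchSwinnertonDyer.BirchSwinnertonDyer.Theorems.AlignedTransportAtTwoSexticNormRelationDescent
  Summit.BirchSwinnertonDyer.BirchSwinnertonDyer.Theorems.AlignedTransportAtTwoPointFieldCarrierCMIff
  Summit.BirchSwinnertonDyer.BirchSwinnertonDyer.Theorems.AlignedTransportAtTwoCubicNarrowRankDoorModelsAnyRung
open Literature.NumberTheory.NumberFields (narrowClassNumber NarrowClassGroup)

variable (W : WeierstrassCurve ℚ) [W.IsElliptic]

/-- ★★★ **PFμ⁺ IS A NARROW RANK-STABILISATION STATEMENT ABOUT THE CUBIC POINT FIELD, curve by curve, both signs.** On the crux's binders (`W` globally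
minimal, good ordinary at `2`, no rational `2`-torsion abscissa, `Δ_W ∉ ℚ²`), for `i² = −1` and any `2`-torsion abscissa `β_j`: the conclusion of the
registered stub `PointFieldMuCycAtTwo` for `W` and `i` («`μ₂ = 0` for every cyclotomic `ℤ₂`-extension of `ℚ(W[2]) ⊔ ℚ⟮i⟯`») holds IFF for some `m ≥ 0` every
cyclotomic `ℤ₂`-extension of `ℚ⟮β_j⟯` has equal NARROW `2`-ranks `[Cl⁺ : (Cl⁺)²]` at the layers `m` and `m + 1` (any `NumberField` instances). (Part Iff §7 +
att-p4 g26's `exists_narrowRung_anyRung_iff_narrowMuData`.) Nothing is computed; nothing closed. [cite: Fukuda1994, Thm. 1 (2), p. 264]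
[cite: Iwasawa1973MuInvariants, Thm. 2 and Thm. 3, §3–§4] [cite: Washington1997, §13.3 Prop. 13.22–13.23] -/
theorem classicalMuVanishes_sup_adjoin_I_iff_exists_narrowRung_of_isOrdinaryAt [W.IsGloballyMinimal] (hord : IsOrdinaryAt W 2)
    (ht : ∀ x : ℚ, ¬ HasRationalTwoTorsionX W x) (hsq : ¬ IsSquare W.Δ) {i : AlgebraicClosure ℚ} (hi : i ^ 2 = -1) (j : Fin 3) :
    (∀ κL : ZpExtension ↥(W.divisionField 2 ⊔ IntermediateField.adjoin ℚ ({i} : Set (AlgebraicClosure ℚ))) 2,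
        κL.IsCyclotomic → ClassicalMuVanishes κL) ↔
      ∃ m : ℕ, ∀ κP : ZpExtension ↥(IntermediateField.adjoin ℚ ({xT W two_ne_zero j} : Set (AlgebraicClosure ℚ))) 2, κP.IsCyclotomic →
        ∀ [NumberField (κP.layer m)] [NumberField (κP.layer (m + 1))],
          (powMonoidHom (α := NarrowClassGroup (κP.layer (m + 1))) 2).range.index =
            (powMonoidHom (α := NarrowClassGroup (κP.layer m)) 2).range.index := by
  have hβ : aeval (xT W two_ne_zero j) W.twoTorsionPolynomial.toPoly = 0 :=
    (mem_rootSet_of_ne (twoTorsionPolynomial_toPoly_ne_zero W two_ne_zero)).mp (xT_mem_rootSet W two_ne_zero j)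
  refine (classicalMuVanishes_sup_adjoin_I_iff_classicalMu_and_narrowDefect_le_cubic_of_isOrdinaryAt W hord ht hsq hi j).trans ?_
  refine Iff.trans ?_ (exists_narrowRung_anyRung_iff_narrowMuData W hord ht hβ).symm
  constructor
  · rintro ⟨hμ, D, hD⟩
    refine ⟨D, fun κP hκP ↦ ⟨hμ κP hκP, ?_⟩⟩
    intro n inst
    exact @hD κP hκP n inst
  · rintro ⟨D, hD⟩
    refine ⟨fun κP hκP ↦ (hD κP hκP).1, D, fun κP hκP ↦ ?_⟩
    have h2 := (hD κP hκP).2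
    intro n inst
    exact @h2 n inst

end Summit.BirchSwinnertonDyer.BirchSwinnertonDyer.Theorems.AlignedTransportAtTwoPointFieldCarrierCMNarrowRung

end
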